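import Summits.Langlands.Langlands.Theorems.QuadraticWindowAutomorphicInductionUnramified
import Summits.Langlands.Langlands.Theorems.QuadraticWindowAutomorphicInductionUnramifiedMultisetRigidity
import Summits.Langlands.Langlands.Theorems.QuadraticWindowAutomorphicInductionUnramifiedOffSOfIsobaricFamilies
import HarnessLib

/-!
# Crux `QuadraticWindow.AutomorphicInductionUnramified` (stmt-Langlands-15138), line `Sketch`
# (`s-threaded-comparison`): skeleton (v4 — everything provable has landed)

The crux is verbatim the named fact
`Literature.NumberTheory.Automorphic.automorphicInduction_cyclic_cuspidal_unramified` (cyclic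
automorphic induction of prime degree, cuspidal case, with the Hecke–Satake relation at EVERY finite
place unramified for the data).  The line reads Arthur–Clozel's Thm. 4.2 (e) (Ann. of Math. Stud. 120,
Ch. 3) WITH THE SPHERICAL SET `S` OF THE COMPARISON (4.1) = (4.2) THREADED THROUGH — the Literature
named fact `ArthurClozel1989_descent_of_galOrbit_offS` (landed p96137,
`Literature/NumberTheory/Automorphic/ArthurClozelGalOrbitDescentOffS.lean`), the one theory-sized leaf
`stub_factDescentOffS` — and deduces the crux along the printed proof of Thm. 6.2 (PDF p. 185), all of
which is PROVED and LANDED: `AutomorphicInductionUnramified_of_descentOffS`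
(`Theorems/QuadraticWindowAutomorphicInductionUnramified.lean`, p96695; the former `stub_assembly`),
using `stub_offS_place` (p96337).  Multiplicity one on `L²_cusp(GL_n)` (`multiplicity_one_gl`, named
fact of the tree) is the second leaf (`stub_factMultiplicityOne`): the binder of the leaf under which
"`Π₁ ≇ Π₁^σ`" is the inequality of subspaces of `L²_cusp`.

Registered stubs, v1 (7) → status:
* `stub_offS_place` — LANDED p96337 (`…UnramifiedOffSPlace.lean`);
* `stub_assembly` — PROVED, LANDED p96695 as `AutomorphicInductionUnramified_of_descentOffS`;
* `stub_descent_of_offS` — PROVED, LANDED inside p96137 as `ArthurClozel1989_descent_of_galOrbit_of_offS`;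
* `stub_offS_of_isobaricFamilies` — LANDED p96583 (`…UnramifiedOffSOfIsobaricFamilies.lean`): the leaf
  follows from the controlled trace-identity outputs `hI`, `hId`, `hIeS`, multiplicity one and
  Jacquet–Shalika (2.2)–(2.3) already used by the tree, so it adds no debt beyond the residue recorded
  for `ArthurClozel1989_descent_of_galOrbit`;
* `stub_multiset_eq_of_add_map_mul_eq` — LANDED p96382 (`…UnramifiedMultisetRigidity.lean`; the
  `q`-difference rigidity lemma of the sibling card `level-from-functional-equation`);
* `stub_factDescentOffS`, `stub_factMultiplicityOne` — OPEN BY CONSTRUCTION: named facts of the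
  literature (the comparison of twisted trace formulae; Shalika–Piatetski-Shapiro multiplicity one).

Composition `AutomorphicInductionUnramified_of`: the crux CLOSED MODULO the two named facts.
-/

noncomputable section

open scoped Classical
open NumberField IsDedekindDomain MeasureTheory Filter
open Literature.NumberTheory.Automorphic Literature.NumberTheory.Automorphic.AdelicGroupData
open Literature.NumberTheory.GaloisRepresentations (HeckeCharacter)

-- `Summit.Langlands.Langlands.…` (summit = sub-problem name, D-0017 layout) trips `dupNamespace`.
set_option linter.dupNamespace false

namespace Summit.Langlands.Langlands.Theorems.AutomorphicInductionUnramified.Sketch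

/-- The crux is literally the Literature named fact (sanity, `Iff.rfl`). -/
example : Summit.Langlands.Langlands.Theses.QuadraticWindow.AutomorphicInductionUnramified ↔
    automorphicInduction_cyclic_cuspidal_unramified := Iff.rfl

/-- The leaf refines the tree's Thm. 4.2 (e) `ArthurClozel1989_descent_of_galOrbit` (former stub
`stub_descent_of_offS`, landed inside p96137). -/
example {F E : Type} [Field F] [NumberField F] [Field E] [NumberField E] [Algebra F E] {m : ℕ}
    (hS : ArthurClozel1989_descent_of_galOrbit_offS F E m) : ArthurClozel1989_descent_of_galOrbit F E m :=
  ArthurClozel1989_descent_of_galOrbit_of_offS hS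

/-! ## Fact stubs (named facts of the literature; not provable inside the line) -/

/-- **Fact stub** (XL): Arthur–Clozel's Thm. 4.2 (e) with `S` threaded, every base field, extension
and rank — the Literature named fact `ArthurClozel1989_descent_of_galOrbit_offS`. -/
theorem stub_factDescentOffS :
    ∀ (F E : Type) [Field F] [NumberField F] [Field E] [NumberField E] [Algebra F E] (m : ℕ),
      ArthurClozel1989_descent_of_galOrbit_offS F E m := by
  sorry

/-- **Fact stub**: multiplicity one on `L²_cusp(GL_n)` (Shalika 1974, Piatetski-Shapiro 1979), the
tree's named fact `multiplicity_one_gl`. -/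
theorem stub_factMultiplicityOne :
    ∀ (n : ℕ) (K : Type) [Field K] [NumberField K] (μ : Measure (gl n K).automorphicQuotient)
      [(gl n K).IsAutomorphicMeasure μ], multiplicity_one_gl n K μ := by
  sorry

/-! ## Landed stubs, re-read (sanity that the imports provide the registered signatures) -/

/-- `stub_assembly`, landed as `AutomorphicInductionUnramified_of_descentOffS` (p96695). -/
theorem stub_assembly'
    (hS : ∀ (F E : Type) [Field F] [NumberField F] [Field E] [NumberField E] [Algebra F E] (m : ℕ),
      ArthurClozel1989_descent_of_galOrbit_offS F E m)
    (hm1 : ∀ (n : ℕ) (K : Type) [Field K] [NumberField K] (μ : Measure (gl n K).automorphicQuotient)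
      [(gl n K).IsAutomorphicMeasure μ], multiplicity_one_gl n K μ) :
    Summit.Langlands.Langlands.Theses.QuadraticWindow.AutomorphicInductionUnramified :=
  AutomorphicInductionUnramified_of_descentOffS hS hm1

/-- `stub_multiset_eq_of_add_map_mul_eq`, landed (p96382). -/
theorem multiset_eq_of_add_map_mul_eq' {q : ℂ} (hq : ‖q‖ ≠ 1) (A B : Multiset ℂ)
    (h0 : (0 : ℂ) ∉ A + B) (h : B + A.map (q * ·) = A + B.map (q * ·)) : B = A :=
  stub_multiset_eq_of_add_map_mul_eq hq A B h0 h

/-! ## Composition -/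

/-- **The crux, modulo the registered stubs**: cyclic automorphic induction of prime degree, cuspidal
case, with the Hecke–Satake relation at every unramified place, from the `S`-threaded Thm. 4.2 (e) and
multiplicity one — CLOSED MODULO the two named facts. -/
theorem AutomorphicInductionUnramified_of :
    Summit.Langlands.Langlands.Theses.QuadraticWindow.AutomorphicInductionUnramified :=
  AutomorphicInductionUnramified_of_descentOffS stub_factDescentOffS stub_factMultiplicityOne

end Summit.Langlands.Langlands.Theorems.AutomorphicInductionUnramified.Sketch

end
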